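import Summits.Ventures.HSemireg.SheafSeedOnAnchor
import HarnessLib

/-!
# Venture HSemireg — the AMPLIFICATION CHAIN, assembled DOOR-AGNOSTICALLY:
# «local variational Hodge statement for an object class `𝒪`» ∧ «ONE seed of class `𝒪` on a split CM anchor» ∧ Deligne's reach
# ⟹ the Weil classes are algebraic on every member of the split `ℚ(√-d)`-Weil component (g = 4: abelian FOURFOLDS)

HONEST FRAMING. Lean index of the computation cell `pub-hsemireg` (seat p7, «Lean typer for the amplification chain —
assembly file»). NOTHING about any explicit variety is asserted; every published input is a hypothesis BY NAME; nothing here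
says HC, HC_CM or HC_AV is proved. Abelian fourfolds of Weil type with split discriminant are algebraic IN PRINT (Markman, JEMS 25
(2023); Schoen 1988/1998 for `ℚ(√-3)`): the g = 4 theorem below RE-DERIVES a known case modulo its named hypotheses, it is not a
new case. No `sorry`, no new axiom; five `def`s (predicates), no named fact.

## What «amplification» means here, and why this file is door-agnostic

The cell's chain «semiregular representative at ONE CM point ⟹ the class is algebraic on EVERY member of the component» has two
halves. The AMPLIFICATION half (local algebraicity on an open of a family base ⟹ every fibre ⟹ every member of the component:
Baire / Charles–Schnell, Lefschetz (1,1), «one Weil class suffices», isogeny, Deligne's polarized family) is a TREE THEOREM,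
`WeilTypeLadder.weilClasses_algebraic_hyperbolic_of_localAnchor`, consuming `HasLocallyAlgebraicWeilAnchor n d` (a hyperbolic anchor
`(P, ψ₀, h_K, w)` with the LOCAL CLAUSE `WeilAnchorLocalClause n d P h_K w`) and the refereed reach fact `weilFamilyReach_hyperbolic`.
The LOCAL half is a published semiregularity theorem applied to an OBJECT: Bloch 1972 (7.4) for an lci cycle, Buchweitz–Flenner 2003
Thm. 5.1 for a vector bundle (both rendered in the tree on real carriers; the cell proved one door per object kind, `SubschemeSeed.lean`,
`UnionSeed.lean`, `SheafSeed.lean`, `SheafSeedOnAnchor.lean`, each re-running the same 80-line argument), Pridham 2024 / Perry 2022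
for a perfect complex — the STEP-0 route (C) object (Markman's secant COMPLEX `Φ(I_{p×X ∪ X×q}) ⊗ M_B` on `X × X̂`), whose transfer
theorem the cell's seats p4 / lit-3 are typing (no carrier for its semiregularity clause yet: `theory/TH2-PERRY-ASSEMBLY-TYPABILITY.md`).

THIS FILE therefore abstracts the object away. An OBJECT CLASS is a predicate
`𝒪 : ℕ → (X₀ : SchemeOver ℂ) → Finset ℕ → ((p : ℕ) → H^{2p}(X₀(ℂ); ℂ)) → Prop`, read «in relative dimension `n`, the classes
`(κ_p)_{p ∈ I}` on `X₀` are the characteristic classes of an ADMISSIBLE (= semiregular, in the sense of the door) object of this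
kind on `X₀`». `LocalVariationalHodgeFor 𝒪` is the LOCAL VARIATIONAL STATEMENT FOR `𝒪`: VERBATIM the binders of the tree's
`BuchweitzFlenner2003_variationalHodge_ISemiregular_model` (smooth projective family `π : 𝒳 ⟶ S` over a smooth base,
cohomologically locally trivial `U ∋ s₀`, MODEL ISO `e : X₀ ≅ 𝒳_{s₀}` in the binders, Hodge-along-`U` hypothesis for `p ∈ I`,
conclusion: on an open `W ∋ s₀` the flat transports of `(e⁻¹)^* κ_p`, `p ∈ I`, are algebraic) with
`(ℰ₀, hℰ₀, IsISemiregular hℰ₀ {q | q+1 ∈ I}, C.ch X₀ ℰ₀ p)` replaced by `(κ, 𝒪 n X₀ I κ, κ p)`. Then, ONCE for all doors: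

* `weilAnchorLocalClause_of_localVariationalHodgeFor_of_seedOn`:
  **`LocalVariationalHodgeFor 𝒪 ∧ HasSeedOn 𝒪 n P h w ⟹ WeilAnchorLocalClause n d P h w`** (the proof of th-2's
  `weilAnchorLocalClause_of_BFmodel_of_sheafSeedOn`, with `ch_p(ℰ₀)` replaced by `κ_p`);
* `hasLocallyAlgebraicWeilAnchor_of_localVariationalHodgeFor_of_hyperbolicSeedOn`, and with Deligne's reach
  `splitHyperplane_of_reach_of_localVariationalHodgeFor_of_hyperbolicSeedOn` (any level `N`): every SPLIT `ℚ(√-d)`-Weil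
  `2N`-fold; `weilAlgebraicAll_of_localVariationalHodgeFor_of_hyperbolicSeedOn_lt` (all `2n`-folds, `2 ≤ n < N`, Schoen descent);
* **g = 4**: `weilFourfoldsSplit_of_reach_of_localVariationalHodgeFor_of_hyperbolicSeedOn :
  weilFamilyReach_hyperbolic → LocalVariationalHodgeFor 𝒪 → 0 < d → HasHyperbolicSeedOn 𝒪 2 d → Stubs.WeilAlgebraicSplitHyperplane 2 d`
  and its unfolded reading `weilClassesOf_fourfold_le_algebraicClasses_of_…` (`weilClassesOf A φ 2 d ≤ algebraicClasses A.X 2` for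
  every split `√-d`-Weil fourfold `(A, φ)`).
* SANITY INSTANCE (the abstraction is the right one): `bfSheafClass C` (finite locally free `I`-semiregular `ℰ₀` with
  `κ_p = ch_p(ℰ₀)`) has `localVariationalHodgeFor_bfSheafClass : BuchweitzFlenner2003_variationalHodge_ISemiregular_model →
  LocalVariationalHodgeFor (bfSheafClass C)` (a binder shuffle) and `hasSeedOn_bfSheafClass_of_hasBFSheafSeedOn`, so th-2's one-model
  sheaf door is RECOVERED as `weilAnchorLocalClause_of_BFmodel_of_sheafSeedOn'` (3 lines).

## How route (C) at g = 4 plugs in (the cell's Monday theorem; NOT in this file — its inputs are other seats' files)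

With `𝒪_C n X₀ I κ := ∃ 𝓔` (a perfect complex on `X₀`: seat p6's rendering of `Φ(I_{p×X ∪ X×q}) ⊗ M_B`) `,` (its semiregularity
clause: seat p4 / lit-3, from Pridham 2024 Cor. 2.25 + Rem. 2.27, Perry 2022 Prop. 8.1, Lieblich 2006 Thm. 4.2.1) `∧ ∀ p ∈ I,
κ p = ch_p(𝓔)`, the typed transfer Prop is to IMPLY `LocalVariationalHodgeFor 𝒪_C`; seats p5 (Markman's class statement:
`ch₂(𝓔) = q·h_K² + w`, `w ≠ 0` rational in the Weil plane, `ch_p(𝓔) ∈ ℚ·h_Kᵖ` for `p ≠ 2`) and p6 deliver `HasHyperbolicSeedOn 𝒪_C 2 d`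
for the certified `d`; then `weilFourfoldsSplit_of_reach_of_localVariationalHodgeFor_of_hyperbolicSeedOn` closes g = 4 for that `d`
with exactly those names as hypotheses. NOT HERE: no object, no certificate, no perfect-complex carrier, no named fact, nothing about
non-split components or sixfolds (a seed at level `N ≥ 3` is the cell's OPEN target).

## References

[BuchweitzFlenner2003] §5 Thm. 5.1 (binder SHAPE of `LocalVariationalHodgeFor`; sanity instance); [Bloch1972Semiregularity] Thm. (7.4),
Remark (7.5) (the `a·z₀ + b·l₀ᵖ` seed form); [Deligne1982HodgeCycles] proof of Thm. 4.8 (reach); [vanGeemen1994HodgeAV] 5.2–5.5, 6.9–6.12;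
[Schoen1998HodgeWeilAddendum] §10 (descent); E. Markman, J. Eur. Math. Soc. 25 (2023) (the g = 4 split case in print) and
[Markman2025SecantWeil] Thm. 1.5.1 (preprint, statement only); [Pridham2024Semiregularity] Cor. 2.25, Rem. 2.21/2.27, [Perry2022]
Prop. 8.1, [Lieblich2006] Thm. 4.2.1 (the perfect-complex door's sources, typed elsewhere in the cell; not used in this file).
-/

noncomputable section

open CategoryTheory AlgebraicGeometry
open _root_.Topology _root_.Filter

namespace Summit.Ventures.HSemireg

open Literature.AlgebraicGeometry Literature.AlgebraicGeometry.Motives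
open Literature.AlgebraicGeometry.HodgeTheory
open Literature.AlgebraicTopology.SingularHomology
open Summit.HodgeConjecture.HodgeConjecture.WeilTypeLadder

/-! ## §1 Object classes and the local variational Hodge statement FOR an object class -/

/-- **An OBJECT CLASS with characteristic classes** (PREDICATE SCHEMA, nothing asserted): `𝒪 n X₀ I κ` reads «in relative
dimension `n`, the even-degree classes `(κ_p)_{p ∈ I}` on the `ℂ`-scheme `X₀` are the characteristic classes of an admissible
(semiregular, in the sense of the intended transfer theorem) object of this kind on `X₀`». Instances: `bfSheafClass C` (a finite
locally free `I`-semiregular `ℰ₀`, `κ_p = ch_p(ℰ₀)`; Buchweitz–Flenner Thm. 5.1), and — typed by other seats of the cell — the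
perfect-complex class of route (C). [cite: BuchweitzFlenner2003, §5 (I-semiregular sheaves; the shape abstracted)] -/
abbrev ObjClass : Type 1 :=
  ℕ → (X₀ : SchemeOver ℂ) → Finset ℕ → ((p : ℕ) → complexBetti X₀ (2 * p)) → Prop

/-- **The LOCAL VARIATIONAL HODGE STATEMENT for the object class `𝒪`** (PREDICATE, nothing asserted): VERBATIM the binders of
the tree's named fact `BuchweitzFlenner2003_variationalHodge_ISemiregular_model` (Buchweitz–Flenner 2003 Thm. 5.1 with the model
isomorphism `e : X₀ ≅ 𝒳_{s₀}` in its binders) with the sheaf data `(ℰ₀, hℰ₀, IsISemiregular hℰ₀ {q | q+1 ∈ I}, C.ch X₀ ℰ₀ p)`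
replaced by `(κ, 𝒪 n X₀ I κ, κ p)`: for every smooth projective family `π : 𝒳 ⟶ S` of relative dimension `n` over a smooth
`ℂ`-scheme, cohomologically locally trivial `U ⊆ S(ℂ)` with base point `s₀`, model `e : X₀ ≅ 𝒳_{s₀}`, finite set `I` of degrees
and classes `κ` on `X₀` admissible for `𝒪` — IF for every `p ∈ I` the flat transports of `(e⁻¹)^* κ_p` along all paths in `U` are
of type `(p,p)`, THEN on some open `W`, `s₀ ∈ W ⊆ U`, the transports of `(e⁻¹)^* κ_p` (`p ∈ I`) along paths inside `W` are ALGEBRAIC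
classes of the fibres. For `𝒪 = bfSheafClass C` this IS BF Thm. 5.1 (`localVariationalHodgeFor_bfSheafClass`); for the
perfect-complex class it is the statement Pridham 2024 Cor. 2.25/Rem. 2.27 + Perry 2022 Prop. 8.1 are typed to supply.
[cite: BuchweitzFlenner2003, §5 Thm. 5.1 (binder shape)] -/
def LocalVariationalHodgeFor (𝒪 : ObjClass) : Prop :=
  ∀ ⦃𝒳 S : SchemeOver ℂ⦄ (π : 𝒳 ⟶ S) (n : ℕ),
    IsSmoothProjectiveFamily π n → _root_.AlgebraicGeometry.Smooth S.hom →
    ∀ ⦃U : Set (ComplexPoints S)⦄ (hU : IsCohomologicallyLocallyTrivialOn π U) (s₀ : U)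
      (X₀ : SchemeOver ℂ) (e : X₀ ≅ fiberOver π s₀.1) (I : Finset ℕ) (κ : (p : ℕ) → complexBetti X₀ (2 * p)),
      𝒪 n X₀ I κ →
      (∀ p ∈ I, ∀ (t : U) (γ : Path.Homotopic.Quotient s₀ t),
          IsOfHodgeType n (fiberOver π t.1) (2 * p) p p
            (transportFun π (2 * p) hU γ (complexBetti.map e.inv (2 * p) (κ p)))) →
      ∃ (W : Set (ComplexPoints S)) (hWo : IsOpen W) (hW₀ : s₀.1 ∈ W) (hWU : W ⊆ U),
        ∀ p ∈ I, ∀ (t : W) (γ : Path.Homotopic.Quotient (⟨s₀.1, hW₀⟩ : W) t),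
          transportFun π (2 * p) (hU.mono hWU hWo) γ (complexBetti.map e.inv (2 * p) (κ p)) ∈
            algebraicClasses (fiberOver π t.1) p

/-- **Monotonicity in the object class**: if every `𝒪`-admissible `κ` is `𝒪'`-admissible, the local variational statement for
`𝒪'` gives the one for `𝒪` (a transfer theorem for a WIDER class of objects serves every narrower door). [folklore] -/
theorem LocalVariationalHodgeFor.anti {𝒪 𝒪' : ObjClass} (h𝒪 : ∀ n X₀ I κ, 𝒪 n X₀ I κ → 𝒪' n X₀ I κ)
    (h : LocalVariationalHodgeFor 𝒪') : LocalVariationalHodgeFor 𝒪 :=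
  fun _ _ π n hπ hS _ hU s₀ X₀ e I κ hκ hHodge ↦ h π n hπ hS hU s₀ X₀ e I κ (h𝒪 n X₀ I κ hκ) hHodge

/-- **The Buchweitz–Flenner SHEAF class** (instance of `ObjClass`): `(κ_p)_{p ∈ I}` are the Chern character components
`ch_p(ℰ₀)` (in the Chern character theory `C`) of a finite locally free `ℰ₀` on `X₀` whose semiregularity components
`(σ_{p-1})_{p ∈ I}` are jointly injective (`IsISemiregular hℰ₀ {q | q + 1 ∈ I}`, the tree's form-degree numbering).
[cite: BuchweitzFlenner2003, §5 (I-semiregular) and Thm. 5.1 (hypotheses)] -/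
def bfSheafClass (C : ChernCharacterBetti) : ObjClass := fun _ X₀ I κ ↦
  ∃ (E₀ : X₀.left.Modules) (hE₀ : IsFiniteLocallyFree E₀),
    IsISemiregular hE₀ {q | q + 1 ∈ I} ∧ ∀ p ∈ I, κ p = C.ch X₀ E₀ p

/-- **BF Thm. 5.1 (model rendering) IS the local variational statement for the sheaf class** — a binder shuffle: the
hypotheses and the conclusion for `κ_p` are those for `ch_p(ℰ₀)` after rewriting `κ_p = ch_p(ℰ₀)` on `I`.
[cite: BuchweitzFlenner2003, §5 Thm. 5.1] -/
theorem localVariationalHodgeFor_bfSheafClass (hBF : BuchweitzFlenner2003_variationalHodge_ISemiregular_model)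
    (C : ChernCharacterBetti) : LocalVariationalHodgeFor (bfSheafClass C) := by
  intro 𝒳 S π n hπ hS U hU s₀ X₀ e I κ hκ hHodge
  obtain ⟨E₀, hE₀, hsr, hch⟩ := hκ
  have hHodge' : ∀ p ∈ I, ∀ (t : U) (γ : Path.Homotopic.Quotient s₀ t),
      IsOfHodgeType n (fiberOver π t.1) (2 * p) p p
        (transportFun π (2 * p) hU γ (complexBetti.map e.inv (2 * p) (C.ch X₀ E₀ p))) := by
    intro p hp t γ
    rw [← hch p hp]
    exact hHodge p hp t γ
  obtain ⟨W, hWo, hW₀, hWU, hW⟩ := hBF C π n hπ hS hU s₀ X₀ e E₀ hE₀ I hsr hHodge'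
  refine ⟨W, hWo, hW₀, hWU, fun p hp t γ ↦ ?_⟩
  rw [hch p hp]
  exact hW p hp t γ

/-! ## §2 ONE seed of class `𝒪` on an anchor, and the door to the local clause -/

/-- **A seed of class `𝒪` for `q·hⁿ + w` ON the abelian variety `P`** (PREDICATE, nothing asserted; a DESIGN input): a finite
set of degrees `I ∋ n`, classes `κ` on `P.X` admissible for `𝒪` in relative dimension `2n`, and `q ∈ ℚ`, `c : ℕ → ℚ` with
`κ_n = q·hⁿ + w` and `κ_p = c_p·hᵖ` for `p ∈ I`, `p ≠ n` (Bloch's Remark (7.5) form `a·z₀ + b·l₀ᵖ`, normalised). For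
`𝒪 = bfSheafClass C` this is th-2's `HasBFSheafSeedOn C n I P h w` (`hasSeedOn_bfSheafClass_of_hasBFSheafSeedOn`).
[cite: Bloch1972Semiregularity, Remark (7.5)] [cite: BuchweitzFlenner2003, §5 Thm. 5.1 (hypotheses)] -/
def HasSeedOn (𝒪 : ObjClass) (n : ℕ) (P : AbelianVariety ℂ) (h : complexBetti P.X 2)
    (w : complexBetti P.X (2 * n)) : Prop :=
  ∃ (I : Finset ℕ) (κ : (p : ℕ) → complexBetti P.X (2 * p)) (q : ℚ) (c : ℕ → ℚ),
    n ∈ I ∧ 𝒪 (2 * n) P.X I κ ∧ κ n = ((q : ℚ) : ℂ) • cupPowTwo h n + w ∧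
    ∀ p ∈ I, p ≠ n → κ p = ((c p : ℚ) : ℂ) • cupPowTwo h p

/-- A seed of a narrower class is a seed of any wider class. [folklore] -/
theorem HasSeedOn.mono {𝒪 𝒪' : ObjClass} (h𝒪 : ∀ n X₀ I κ, 𝒪 n X₀ I κ → 𝒪' n X₀ I κ) {n : ℕ} {P : AbelianVariety ℂ}
    {h : complexBetti P.X 2} {w : complexBetti P.X (2 * n)} (hS : HasSeedOn 𝒪 n P h w) : HasSeedOn 𝒪' n P h w :=
  let ⟨I, κ, q, c, hnI, hκ, hn, hp⟩ := hS; ⟨I, κ, q, c, hnI, h𝒪 _ _ _ _ hκ, hn, hp⟩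

/-- th-2's one-model sheaf seed is a seed of the sheaf class (`κ_p := ch_p(ℰ₀)`).
[cite: BuchweitzFlenner2003, §5 (I-semiregular)] -/
theorem hasSeedOn_bfSheafClass_of_hasBFSheafSeedOn {C : ChernCharacterBetti} {n : ℕ} {I : Finset ℕ}
    {P : AbelianVariety ℂ} {h : complexBetti P.X 2} {w : complexBetti P.X (2 * n)} (hS : HasBFSheafSeedOn C n I P h w) :
    HasSeedOn (bfSheafClass C) n P h w := by
  obtain ⟨E₀, hE₀, q, c, hnI, hsr, hchn, hchp⟩ := hS
  exact ⟨I, fun p ↦ C.ch P.X E₀ p, q, c, hnI, ⟨E₀, hE₀, hsr, fun _ _ ↦ rfl⟩, hchn, hchp⟩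

/-- **THE DOOR, once for all object kinds: `LocalVariationalHodgeFor 𝒪 ∧ HasSeedOn 𝒪 n P h w ⟹ WeilAnchorLocalClause n d P h w`**
(every `d`). Proof = th-2's `weilAnchorLocalClause_of_BFmodel_of_sheafSeedOn` with `ch_p(ℰ₀)` replaced by `κ_p`: along a Weil
family `f : 𝒳 ⟶ S` through the chart `e₀ : P.X ≅ 𝒳_{s₀}` with global classes `H ↦ h`, `W ↦ w`, the local system `R f_*ℂ` is
trivialised over all of `S(ℂ)` (Ehresmann), the classes `(e₀⁻¹)^* κ_n = (q·Hⁿ + W)|_{s₀}` and `(e₀⁻¹)^* κ_p = c_p·Hᵖ|_{s₀}` are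
restrictions of global classes whose restrictions are everywhere of type `(p,p)`, so the local statement applies at the model
`e₀`; its open `W' ∋ s₀` contains the path component of `s₀`, on which `q·H_sⁿ + W_s` is algebraic.
[cite: BuchweitzFlenner2003, §5 Thm. 5.1 (the argument shape)] [cite: VoisinHodgeI2002, §9.2.1 and Thm. 9.3] -/
theorem weilAnchorLocalClause_of_localVariationalHodgeFor_of_seedOn {𝒪 : ObjClass} {n : ℕ} (d : ℕ)
    (hT : LocalVariationalHodgeFor 𝒪) {P : AbelianVariety ℂ} {h : complexBetti P.X 2} {w : complexBetti P.X (2 * n)}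
    (hS : HasSeedOn 𝒪 n P h w) : WeilAnchorLocalClause n d P h w := by
  intro 𝒳 S f hf _ hSqp hSirr hsm _ H W hH hW s₀ e₀ hH₀ hW₀
  -- (1) `Rⁱf_*ℂ` is a local system on all of `S(ℂ)`, a path connected, locally path connected manifold
  haveI := hSirr
  haveI := hsm
  haveI : LocallyOfFiniteType S.hom := hSqp.locallyOfFiniteType
  haveI : ConnectedSpace (ComplexPoints S) := (ComplexPoints.connectedSpace_iff_holds S).2 inferInstance
  obtain ⟨dS, hd⟩ := exists_smoothOfRelativeDimension_of_connectedSpace_complexPoints S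
  haveI := hd
  haveI := pathConnectedSpace_complexPoints_of_smoothOfRelativeDimension S dS
  have hU : IsCohomologicallyLocallyTrivialOn f (Set.univ : Set (ComplexPoints S)) :=
    isCohomologicallyLocallyTrivialOn_univ_of_isSmoothProjectiveFamily f dS hf hSqp
  letI := ComplexPoints.chartedSpace S dS
  haveI : LocallyPathConnectedSpace (ComplexPoints S) :=
    ChartedSpace.locallyPathConnectedSpace (EuclideanSpace ℝ (Fin (2 * dS))) (ComplexPoints S)
  let s₀' : (Set.univ : Set (ComplexPoints S)) := ⟨s₀, Set.mem_univ s₀⟩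
  -- (2) the seed of class `𝒪` on `P.X`
  obtain ⟨I, κ, q, c, hnI, hκ, hκn, hκp⟩ := hS
  -- the global class `B := q·Hⁿ + W` and its fibre restrictions
  set Bcl : complexBetti 𝒳 (2 * n) := ((q : ℚ) : ℂ) • cupPowTwo H n + W with hBdef
  have hres : ∀ s : ComplexPoints S, complexBetti.map (fiberι f s) (2 * n) Bcl =
      ((q : ℚ) : ℂ) • cupPowTwo (complexBetti.map (fiberι f s) 2 H) n + complexBetti.map (fiberι f s) (2 * n) W := by
    intro s
    rw [hBdef, map_add, map_smul, complexBetti_map_cupPowTwo']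
  have hBrat : ∀ s : ComplexPoints S,
      IsOfHodgeType (2 * n) (fiberOver f s) (2 * n) n n (complexBetti.map (fiberι f s) (2 * n) Bcl) := by
    intro s
    rw [hres]
    exact ((isOfHodgeType_cupPowTwo (hf.isSmoothProjective s) (hH s).2 n).smul _).add (hf.isSmoothProjective s) (hW s).2
  have hHp₀ : ∀ p : ℕ, complexBetti.map e₀.hom (2 * p) (complexBetti.map (fiberι f s₀) (2 * p) (cupPowTwo H p)) =
      cupPowTwo h p := by
    intro p
    rw [complexBetti_map_cupPowTwo', complexBetti_map_cupPowTwo', hH₀]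
  -- `(e₀⁻¹)^* κ_n = B|_{s₀}` and `(e₀⁻¹)^* κ_p = c_p·Hᵖ|_{s₀}` (compare after pulling back by the iso `e₀`)
  have hκn' : complexBetti.map e₀.inv (2 * n) (κ n) = complexBetti.map (fiberι f s₀) (2 * n) Bcl := by
    apply complexBetti.map_injective_of_iso e₀ (2 * n)
    rw [BuchweitzFlenner2003_variationalHodge_ISemiregular_model.map_hom_map_inv, hκn, hres, map_add, map_smul,
      complexBetti_map_cupPowTwo', hH₀, hW₀]
  have hκp' : ∀ p ∈ I, p ≠ n → complexBetti.map e₀.inv (2 * p) (κ p) =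
      complexBetti.map (fiberι f s₀) (2 * p) (((c p : ℚ) : ℂ) • cupPowTwo H p) := by
    intro p hp hpn
    apply complexBetti.map_injective_of_iso e₀ (2 * p)
    rw [BuchweitzFlenner2003_variationalHodge_ISemiregular_model.map_hom_map_inv, hκp p hp hpn, map_smul, map_smul,
      hHp₀ p]
  -- (3) the Hodge hypothesis of the local statement over `U = S(ℂ)`: all transports of `(e₀⁻¹)^* κ_p`, `p ∈ I`, are `(p,p)`
  have hHodge : ∀ p ∈ I, ∀ (t : (Set.univ : Set (ComplexPoints S))) (γ : Path.Homotopic.Quotient s₀' t),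
      IsOfHodgeType (2 * n) (fiberOver f t.1) (2 * p) p p
        (transportFun f (2 * p) hU γ (complexBetti.map e₀.inv (2 * p) (κ p))) := by
    intro p hp t γ
    by_cases hpn : p = n
    · subst hpn
      rw [hκn', transportFun_map_fiberι f (2 * p) hU γ Bcl]
      exact hBrat t.1
    · rw [hκp' p hp hpn, transportFun_map_fiberι f (2 * p) hU γ, map_smul, complexBetti_map_cupPowTwo']
      exact (isOfHodgeType_cupPowTwo (hf.isSmoothProjective t.1) (hH t.1).2 p).smul _
  obtain ⟨W', hWo, hW'₀, hWU, hW'⟩ := hT f (2 * n) hf hsm hU s₀' P.X e₀ I κ hκ hHodge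
  -- (4) conclude on the path component of `s₀` in `W'`
  refine ⟨pathComponentIn W' s₀, q, hWo.pathComponentIn s₀, mem_pathComponentIn_self hW'₀, fun t ht ↦ ?_⟩
  have hj : JoinedIn W' s₀ t := ht
  have hpm : ∀ u, hj.somePath u ∈ W' := hj.somePath_mem
  let γ : Path (⟨s₀, hW'₀⟩ : W') ⟨t, pathComponentIn_subset ht⟩ :=
    { toFun := fun u ↦ ⟨hj.somePath u, hpm u⟩
      continuous_toFun := hj.somePath.continuous.subtype_mk _
      source' := Subtype.ext hj.somePath.source
      target' := Subtype.ext hj.somePath.target }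
  have hmem := hW' n hnI ⟨t, pathComponentIn_subset ht⟩ ⟦γ⟧
  have htr : transportFun f (2 * n) (hU.mono hWU hWo) ⟦γ⟧ (complexBetti.map e₀.inv (2 * n) (κ n)) =
      complexBetti.map (fiberι f t) (2 * n) Bcl := by
    rw [hκn']
    exact transportFun_map_fiberι f (2 * n) (hU.mono hWU hWo) ⟦γ⟧ Bcl
  change transportFun f (2 * n) (hU.mono hWU hWo) ⟦γ⟧ (complexBetti.map e₀.inv (2 * n) (κ n)) ∈ _ at hmem
  rw [htr, hres] at hmem
  exact hmem

/-- **SANITY INSTANCE — th-2's one-model sheaf door, recovered through the abstraction** (same statement as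
`weilAnchorLocalClause_of_BFmodel_of_sheafSeedOn`, proved in three lines from the door-agnostic theorem).
[cite: BuchweitzFlenner2003, §5 Thm. 5.1] -/
theorem weilAnchorLocalClause_of_BFmodel_of_sheafSeedOn' {n : ℕ} (d : ℕ) (C : ChernCharacterBetti) {I : Finset ℕ}
    (hBF : BuchweitzFlenner2003_variationalHodge_ISemiregular_model) {P : AbelianVariety ℂ} {h : complexBetti P.X 2}
    {w : complexBetti P.X (2 * n)} (hS : HasBFSheafSeedOn C n I P h w) : WeilAnchorLocalClause n d P h w :=
  weilAnchorLocalClause_of_localVariationalHodgeFor_of_seedOn d (localVariationalHodgeFor_bfSheafClass hBF C)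
    (hasSeedOn_bfSheafClass_of_hasBFSheafSeedOn hS)

/-- **`HasLocallyAlgebraicWeilAnchor N d` from ONE seed of class `𝒪` on a split anchor** (unbundled binders; the input of the
tree's amplification engine `weilClasses_algebraic_hyperbolic_of_localAnchor` and of `TenfoldDoor.weilAlgebraicAll_of_localAnchor_lt`):
a complex abelian `2N`-fold `P` with `ψ₀ ≫ ψ₀ = -d`, a projective embedding `e` and rational `a ≠ 0` with `(P, ψ₀)` of hyperbolic Weil
type for `h_K = d·e^*a + ψ₀^*e^*a`, a non-zero rational Weil class `w`, the local variational statement for `𝒪`, and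
`HasSeedOn 𝒪 N P h_K w`. [cite: Deligne1982HodgeCycles, proof of Thm. 4.8] [cite: vanGeemen1994HodgeAV, 5.2–5.4] -/
theorem hasLocallyAlgebraicWeilAnchor_of_localVariationalHodgeFor_of_seedOn {𝒪 : ObjClass} {N d : ℕ}
    (hT : LocalVariationalHodgeFor 𝒪) (P : AbelianVariety ℂ) (ψ₀ : P ⟶ P) (e : ProjectiveEmbedding P.X)
    (a : complexBetti (projectiveSpace e.n ℂ) 2) (w : complexBetti P.X (2 * N)) (hP : P.dim = 2 * N)
    (hψ : ψ₀ ≫ ψ₀ = -(d • 𝟙 P)) (ha : IsRationalClass a) (ha0 : a ≠ 0)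
    (hhyp : IsHyperbolicWeilType P ψ₀ N
      ((d : ℂ) • complexBetti.map e.ι 2 a + complexBetti.map ψ₀.hom.hom.hom 2 (complexBetti.map e.ι 2 a)))
    (hwW : w ∈ weilClassesOf P ψ₀ N d) (hwr : IsRationalClass w) (hw0 : w ≠ 0)
    (hS : HasSeedOn 𝒪 N P
      ((d : ℂ) • complexBetti.map e.ι 2 a + complexBetti.map ψ₀.hom.hom.hom 2 (complexBetti.map e.ι 2 a)) w) :
    HasLocallyAlgebraicWeilAnchor N d :=
  (hasLocallyAlgebraicWeilAnchor_iff N d).2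
    ⟨P, ψ₀, e, a, w, hP, hψ, ha, ha0, hhyp, hwW, hwr, hw0, weilAnchorLocalClause_of_localVariationalHodgeFor_of_seedOn d hT hS⟩

/-! ## §3 Hyperbolic seeds of class `𝒪`; every split `ℚ(√-d)`-Weil `2N`-fold; the cells below -/

section Hyperbolic

open Summit.HodgeConjecture.HodgeConjecture
open Summit.HodgeConjecture.HodgeConjecture.Cruxes.HodgeAbelianVarieties.EStepSecantInduction
open Summit.Ventures.HSemireg.GeneralStructure

/-- **`HasHyperbolicSeedOn 𝒪 N d` — a hyperbolic seed of class `𝒪` at level `N` for `K = ℚ(√-d)`, ONE object on ONE model**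
(PREDICATE, nothing asserted; the cell's census rows are its intended witnesses): a complex abelian `2N`-fold `P` with
`ψ₀ ≫ ψ₀ = -(d • 𝟙 P)`, a projective embedding `e` and a rational `a ≠ 0` with `(P, ψ₀)` of HYPERBOLIC (split) Weil type for
`h_K = d·e^*a + ψ₀^*e^*a`, a non-zero rational class `w` of the Weil plane `weilClassesOf P ψ₀ N d`, and `HasSeedOn 𝒪 N P h_K w`.
Verbatim the binders of `HasHyperbolicBFSheafSeedOn C N d I` with the sheaf seed replaced by the class-`𝒪` seed.
[cite: vanGeemen1994HodgeAV, 5.2–5.4 (Weil type, hyperbolic = split)] [cite: Bloch1972Semiregularity, Remark (7.5)] -/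
def HasHyperbolicSeedOn (𝒪 : ObjClass) (N d : ℕ) : Prop :=
  ∃ (P : AbelianVariety ℂ) (ψ₀ : P ⟶ P) (e : ProjectiveEmbedding P.X) (a : complexBetti (projectiveSpace e.n ℂ) 2)
    (w : complexBetti P.X (2 * N)),
    P.dim = 2 * N ∧ ψ₀ ≫ ψ₀ = -(d • 𝟙 P) ∧ IsRationalClass a ∧ a ≠ 0 ∧
    IsHyperbolicWeilType P ψ₀ N
      ((d : ℂ) • complexBetti.map e.ι 2 a + complexBetti.map ψ₀.hom.hom.hom 2 (complexBetti.map e.ι 2 a)) ∧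
    w ∈ weilClassesOf P ψ₀ N d ∧ IsRationalClass w ∧ w ≠ 0 ∧
    HasSeedOn 𝒪 N P ((d : ℂ) • complexBetti.map e.ι 2 a + complexBetti.map ψ₀.hom.hom.hom 2 (complexBetti.map e.ι 2 a)) w

/-- A hyperbolic seed of a narrower class is one of any wider class. [folklore] -/
theorem HasHyperbolicSeedOn.mono {𝒪 𝒪' : ObjClass} (h𝒪 : ∀ n X₀ I κ, 𝒪 n X₀ I κ → 𝒪' n X₀ I κ) {N d : ℕ}
    (hS : HasHyperbolicSeedOn 𝒪 N d) : HasHyperbolicSeedOn 𝒪' N d := by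
  obtain ⟨P, ψ₀, e, a, w, hP, hψ, ha, ha0, hhyp, hwW, hwr, hw0, hseed⟩ := hS
  exact ⟨P, ψ₀, e, a, w, hP, hψ, ha, ha0, hhyp, hwW, hwr, hw0, hseed.mono h𝒪⟩

/-- th-2's hyperbolic one-model sheaf seed is a hyperbolic seed of the sheaf class.
[cite: BuchweitzFlenner2003, §5 (I-semiregular)] -/
theorem hasHyperbolicSeedOn_bfSheafClass_of_hasHyperbolicBFSheafSeedOn {C : ChernCharacterBetti} {N d : ℕ} {I : Finset ℕ}
    (hS : HasHyperbolicBFSheafSeedOn C N d I) : HasHyperbolicSeedOn (bfSheafClass C) N d := by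
  obtain ⟨P, ψ₀, e, a, w, hP, hψ, ha, ha0, hhyp, hwW, hwr, hw0, hseed⟩ := hS
  exact ⟨P, ψ₀, e, a, w, hP, hψ, ha, ha0, hhyp, hwW, hwr, hw0, hasSeedOn_bfSheafClass_of_hasBFSheafSeedOn hseed⟩

/-- **`LocalVariationalHodgeFor 𝒪 ∧ HasHyperbolicSeedOn 𝒪 N d ⟹ HasLocallyAlgebraicWeilAnchor N d`** (the anchor currency of the
tree's amplification engine, from one hyperbolic seed of ANY class with its transfer statement).
[cite: Deligne1982HodgeCycles, proof of Thm. 4.8] [cite: vanGeemen1994HodgeAV, 5.2–5.4] -/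
theorem hasLocallyAlgebraicWeilAnchor_of_localVariationalHodgeFor_of_hyperbolicSeedOn {𝒪 : ObjClass} {N d : ℕ}
    (hT : LocalVariationalHodgeFor 𝒪) (hS : HasHyperbolicSeedOn 𝒪 N d) : HasLocallyAlgebraicWeilAnchor N d := by
  obtain ⟨P, ψ₀, e, a, w, hP, hψ, ha, ha0, hhyp, hwW, hwr, hw0, hseed⟩ := hS
  exact hasLocallyAlgebraicWeilAnchor_of_localVariationalHodgeFor_of_seedOn hT P ψ₀ e a w hP hψ ha ha0 hhyp hwW hwr hw0 hseed

/-- **AMPLIFICATION at ONE level `(N, d)`: Deligne's reach ∧ the local variational statement for `𝒪` ∧ ONE hyperbolic seed of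
class `𝒪` ⟹ the Weil classes of every SPLIT `ℚ(√-d)`-Weil `2N`-fold are algebraic** (`Stubs.WeilAlgebraicSplitHyperplane N d`), by
the tree engine `weilClasses_algebraic_hyperbolic_of_localAnchor` (Baire/Charles–Schnell spreading, Lefschetz (1,1), one Weil class
suffices, isogeny). [cite: Deligne1982HodgeCycles, proof of Thm. 4.8] [cite: vanGeemen1994HodgeAV, proof of Thm. 6.12]
[cite: CharlesSchnell2014Notes, Prop. 11.3.11 (proof)] -/
theorem splitHyperplane_of_reach_of_localVariationalHodgeFor_of_hyperbolicSeedOn (hF : weilFamilyReach_hyperbolic)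
    {𝒪 : ObjClass} {N d : ℕ} (hN : 1 ≤ N) (hd : 0 < d) (hT : LocalVariationalHodgeFor 𝒪) (hS : HasHyperbolicSeedOn 𝒪 N d) :
    Stubs.WeilAlgebraicSplitHyperplane N d := by
  intro A φ e a hA hφ ha ha0 hhyp c hcW _ _
  exact weilClasses_algebraic_hyperbolic_of_localAnchor N d hN hd
    (hasLocallyAlgebraicWeilAnchor_of_localVariationalHodgeFor_of_hyperbolicSeedOn hT hS) hF A φ hA hφ e a ha ha0 hhyp hcW

/-- **Below the seed level** (Schoen's descent, the tree's `stub_descend` iterated): reach ∧ the local variational statement for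
`𝒪` ∧ ONE hyperbolic seed of class `𝒪` at level `N` for `K = ℚ(√-d)` ⟹ `WeilAlgebraicAll n d` for every `2 ≤ n < N` (every
discriminant, split and non-split). [cite: Schoen1998HodgeWeilAddendum, §10] [cite: Deligne1982HodgeCycles, proof of Thm. 4.8] -/
theorem weilAlgebraicAll_of_localVariationalHodgeFor_of_hyperbolicSeedOn_lt (hF : weilFamilyReach_hyperbolic) {𝒪 : ObjClass}
    {N d : ℕ} (hT : LocalVariationalHodgeFor 𝒪) (hS : HasHyperbolicSeedOn 𝒪 N d) {n : ℕ} (hn : 2 ≤ n) (hnN : n < N)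
    (hd : 0 < d) : WeilAlgebraicAll n d :=
  weilAlgebraicAll_of_splitHyperplane_lt hn hnN hd
    (splitHyperplane_of_reach_of_localVariationalHodgeFor_of_hyperbolicSeedOn hF (by omega) hd hT hS)

/-! ## §4 g = 4 — the terminus of the amplification chain on the split Weil component of abelian FOURFOLDS -/

/-- **g = 4, the cell's in-tree CONDITIONAL THEOREM in door-agnostic form.** Hypotheses BY NAME: Deligne's hyperbolic reach
`weilFamilyReach_hyperbolic` (refereed named fact), the local variational Hodge statement `LocalVariationalHodgeFor 𝒪` for the
object class `𝒪` (for sheaves: BF Thm. 5.1; for route (C)'s perfect complex: the Prop typed from Pridham 2024 / Perry 2022 by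
the cell's seats), and ONE hyperbolic seed of class `𝒪` on a split `ℚ(√-d)`-Weil abelian fourfold (`HasHyperbolicSeedOn 𝒪 2 d`:
the STEP-0 object at the CM point `X × X̂` with its certificate, as delivered by the cell). Conclusion: the Weil classes of EVERY
split `√-d`-Weil abelian fourfold are algebraic (`Stubs.WeilAlgebraicSplitHyperplane 2 d`) — Markman's theorem for that component,
re-derived; NOT a new case, and nothing about non-split components. [cite: Markman2023GeneralizedKummers, Theorem 1.5 (= Theorem 13.4), p. 236 (in print; arXiv:1805.11574 pre-publication numbering: Theorem 1.3)] [cite: Markman2025SecantWeil, Thm. 1.5.1 (statement re-derived; preprint)]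
[cite: Deligne1982HodgeCycles, proof of Thm. 4.8] [cite: vanGeemen1994HodgeAV, proof of Thm. 6.12] -/
theorem weilFourfoldsSplit_of_reach_of_localVariationalHodgeFor_of_hyperbolicSeedOn (hF : weilFamilyReach_hyperbolic)
    {𝒪 : ObjClass} (hT : LocalVariationalHodgeFor 𝒪) {d : ℕ} (hd : 0 < d) (hS : HasHyperbolicSeedOn 𝒪 2 d) :
    Stubs.WeilAlgebraicSplitHyperplane 2 d :=
  splitHyperplane_of_reach_of_localVariationalHodgeFor_of_hyperbolicSeedOn hF (by norm_num) hd hT hS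

/-- **g = 4, unfolded reading** (the sentence of the report): under the same three named hypotheses, for every complex abelian
FOURFOLD `A` with `φ ≫ φ = -(d • 𝟙 A)`, every projective embedding `e_A` and rational `a_A ≠ 0` such that `(A, φ)` is of hyperbolic
(= split) Weil type for `h_K = d·e_A^*a_A + φ^*e_A^*a_A`, the whole Weil plane `weilClassesOf A φ 2 d ⊆ H⁴(A(ℂ); ℂ)` consists of
algebraic classes. [cite: Markman2023GeneralizedKummers, Theorem 1.5 (= Theorem 13.4), p. 236 (in print; arXiv:1805.11574 pre-publication numbering: Theorem 1.3)] [cite: Markman2025SecantWeil, Thm. 1.5.1 (statement re-derived; preprint)] [cite: Deligne1982HodgeCycles, proof of Thm. 4.8] -/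
theorem weilClassesOf_fourfold_le_algebraicClasses_of_reach_of_localVariationalHodgeFor_of_hyperbolicSeedOn
    (hF : weilFamilyReach_hyperbolic) {𝒪 : ObjClass} (hT : LocalVariationalHodgeFor 𝒪) {d : ℕ} (hd : 0 < d)
    (hS : HasHyperbolicSeedOn 𝒪 2 d) (A : AbelianVariety ℂ) (φ : A ⟶ A) (hA : A.dim = 2 * 2) (hφ : φ ≫ φ = -(d • 𝟙 A))
    (eA : ProjectiveEmbedding A.X) (aA : complexBetti (projectiveSpace eA.n ℂ) 2) (haA : IsRationalClass aA) (haA0 : aA ≠ 0)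
    (hhypA : IsHyperbolicWeilType A φ 2
      ((d : ℂ) • complexBetti.map eA.ι 2 aA + complexBetti.map φ.hom.hom.hom 2 (complexBetti.map eA.ι 2 aA))) :
    weilClassesOf A φ 2 d ≤ algebraicClasses A.X 2 :=
  weilClasses_algebraic_hyperbolic_of_localAnchor 2 d (by norm_num) hd
    (hasLocallyAlgebraicWeilAnchor_of_localVariationalHodgeFor_of_hyperbolicSeedOn hT hS) hF A φ hA hφ eA aA haA haA0 hhypA

/-- **g = 4 through the SHEAF door** (instance, for the record; no such vector bundle is claimed by the cell — the STEP-0 (C) object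
is a perfect complex): reach ∧ BF Thm. 5.1 (model rendering) ∧ ONE hyperbolic one-model `I`-semiregular vector-bundle seed on a split
`ℚ(√-d)`-Weil fourfold ⟹ every split `√-d`-Weil fourfold. [cite: BuchweitzFlenner2003, §5 Thm. 5.1] [cite: Deligne1982HodgeCycles, proof of Thm. 4.8] -/
theorem weilFourfoldsSplit_of_reach_of_BFmodel_of_hyperbolicBFSheafSeedOn (hF : weilFamilyReach_hyperbolic)
    {C : ChernCharacterBetti} {I : Finset ℕ} (hBF : BuchweitzFlenner2003_variationalHodge_ISemiregular_model) {d : ℕ}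
    (hd : 0 < d) (hS : HasHyperbolicBFSheafSeedOn C 2 d I) : Stubs.WeilAlgebraicSplitHyperplane 2 d :=
  weilFourfoldsSplit_of_reach_of_localVariationalHodgeFor_of_hyperbolicSeedOn hF (localVariationalHodgeFor_bfSheafClass hBF C) hd
    (hasHyperbolicSeedOn_bfSheafClass_of_hasHyperbolicBFSheafSeedOn hS)

end Hyperbolic

/-! ## Audit: nothing is decided here
Every theorem above with a Weil conclusion carries among its hypotheses a SEED (`HasSeedOn 𝒪 …` / `HasHyperbolicSeedOn 𝒪 …`, the
cell's computation targets) AND `LocalVariationalHodgeFor 𝒪` for the same class (published for sheaves / lci; for perfect complexes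
a Prop typed elsewhere in the cell), plus the refereed reach fact `weilFamilyReach_hyperbolic` BY NAME. `HC_CM`, CM density,
Mumford–Tate finiteness do not occur. Five new `def`s (predicates / a type of predicates), no named fact. -/

end Summit.Ventures.HSemireg

end
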